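import Literature.MathematicalPhysics.QuantumManyBody.JelliumSlicePQBridge
import HarnessLib

/-!
# Continuity of the condensate projections `PⱼΨ`, `QⱼΨ` of a continuous `n`-body function

Topic `Literature/MathematicalPhysics/QuantumManyBody` (the charged Bose gas, `JelliumBoseGas.foldyLaw`).
Technical input for the first-quantized [LiebSolovej2001, §5] (Lemmas 5.2–5.6 manipulate products
`PᵢQⱼΨ`, `QᵢQⱼΨ`, … of the projections, whose measurability and boundedness on the box we obtain
from continuity): `X ↦ (PⱼΨ)(X) = ⨍_Λ Ψ(X; xⱼ ↦ y) dy` is continuous for continuous `Ψ` (a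
parametric integral of a continuous function over the compact closed cube), hence so are `QⱼΨ`
and all finite composites of the projections.

* `isCompact_closedCube`, `continuous_sliceMean`, `continuous_sliceFluct`.

## References

* [LiebSolovej2001] E. H. Lieb, J. P. Solovej, Commun. Math. Phys. 217 (2001) 127–163, §5.
-/

noncomputable section

open MeasureTheory Set Filter Real
open scoped ENNReal NNReal Topology

namespace Literature.MathematicalPhysics.QuantumManyBody.JelliumBoseGas

open BoseGas

variable {n : ℕ}

/-- The closed cube `[0,ℓ]³` (coordinate form) is the image of `[0,ℓ]^{Fin 3}`. [folklore] -/
theorem closedCube_eq_image (ℓ : ℝ) :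
    {x : Space | ∀ k, x k ∈ Set.Icc 0 ℓ} =
      (WithLp.toLp 2 '' Set.univ.pi fun _ : Fin 3 => Set.Icc (0 : ℝ) ℓ : Set Space) := by
  ext x
  simp only [Set.mem_setOf_eq, Set.mem_image, Set.mem_univ_pi]
  constructor
  · intro h; exact ⟨WithLp.ofLp x, h, rfl⟩
  · rintro ⟨f, hf, rfl⟩; exact hf

/-- The closed cube `[0,ℓ]³` is compact. [folklore] -/
theorem isCompact_closedCube (ℓ : ℝ) : IsCompact {x : Space | ∀ k, x k ∈ Set.Icc 0 ℓ} := by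
  rw [closedCube_eq_image]; exact isCompact_closedBox ℓ

/-- **`PⱼΨ` is continuous for continuous `Ψ`.** [folklore] -/
theorem continuous_sliceMean (ℓ : ℝ) (j : Fin n) {Ψ : Config n → ℂ} (hΨ : Continuous Ψ) :
    Continuous (sliceMean ℓ j Ψ) := by
  have hf : Continuous (Function.uncurry fun (X : Config n) (y : Space) => Ψ (Function.update X j y)) :=
    hΨ.comp (continuous_fst.update j continuous_snd)
  have hc : Continuous fun X : Config n => ∫ y in {x : Space | ∀ k, x k ∈ Set.Icc 0 ℓ},
      Ψ (Function.update X j y) :=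
    continuous_parametric_integral_of_continuous hf (isCompact_closedCube ℓ)
  have e : sliceMean ℓ j Ψ = fun X => (volume.real (cell ℓ))⁻¹ •
      ∫ y in {x : Space | ∀ k, x k ∈ Set.Icc 0 ℓ}, Ψ (Function.update X j y) := by
    funext X
    rw [sliceMean, setAverage_eq, setIntegral_congr_set (cell_ae_eq_closedCube ℓ)]
  rw [e]
  exact hc.const_smul ((volume.real (cell ℓ))⁻¹ : ℝ)

/-- **`QⱼΨ` is continuous for continuous `Ψ`.** [folklore] -/
theorem continuous_sliceFluct (ℓ : ℝ) (j : Fin n) {Ψ : Config n → ℂ} (hΨ : Continuous Ψ) :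
    Continuous (sliceFluct ℓ j Ψ) :=
  hΨ.sub (continuous_sliceMean ℓ j hΨ)

/-- A continuous function is bounded on the fibres through configurations of a compact set; in
particular `sup_{X ∈ closed box^n, y ∈ cell} |F(X; xⱼ ↦ y)| < ∞`. [folklore] -/
theorem exists_bound_update_of_continuous {F : Config n → ℂ} (hF : Continuous F) (ℓ : ℝ) (j : Fin n) :
    ∃ C : ℝ, ∀ X ∈ {X : Config n | ∀ i k, X i k ∈ Set.Icc 0 ℓ}, ∀ y ∈ cell ℓ,
      ‖F (Function.update X j y)‖ ≤ C := by
  have hK : IsCompact ({X : Config n | ∀ i k, X i k ∈ Set.Icc 0 ℓ} ×ˢ {x : Space | ∀ k, x k ∈ Set.Icc 0 ℓ}) := by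
    refine IsCompact.prod ?_ (isCompact_closedCube ℓ)
    have e : {X : Config n | ∀ i k, X i k ∈ Set.Icc 0 ℓ} =
        Set.univ.pi fun _ : Fin n => {x : Space | ∀ k, x k ∈ Set.Icc 0 ℓ} := by
      ext X; simp
    rw [e]
    exact isCompact_univ_pi fun _ => isCompact_closedCube ℓ
  have hc : Continuous fun p : Config n × Space => F (Function.update p.1 j p.2) :=
    hF.comp (continuous_fst.update j continuous_snd)
  obtain ⟨C, hC⟩ := hK.exists_bound_of_continuousOn hc.continuousOn
  exact ⟨C, fun X hX y hy => hC (X, y) ⟨hX, fun k => Set.Ico_subset_Icc_self (hy k)⟩⟩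

end Literature.MathematicalPhysics.QuantumManyBody.JelliumBoseGas
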